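import Summits.QuantumFields.YangMills.Theorems.SwapVirialDeficitBlowUpGnomonicTranslatedDefs
import Summits.QuantumFields.YangMills.Theorems.SwapVirialDeficitBlowUpGnomonicRingChart
import HarnessLib

/-!
# THE σ-GLUED RING MEASURE IN THE TRANSLATED GNOMONIC CHART (`y`-letter left-translated by a unit `u`; sector-001 plumbing of LEAD sfw-p2 g98's
# memo7 plan of record for ⟨stmt-QuantumFields-24197⟩ `SwapVirialDeficit.SwapGluedStiffness`, §E(5))

✓`lintegral_ringMeasure_eq_gnomonic` (w2 g57) reads `dμ_L` in the master chart `gnomonicPoint a ε η`.  Here the SAME identity is proved for the translated chart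
✓`trGnomonicPoint u a ε η` (`C₂ = Q(u·ŷ)`, ✓`…TranslatedDefs`) for every unit `u`, with the SAME constant `coneConst³/64·(2π²)^{-|Fol L|}` and the SAME density
`gnoDensity`: the only new input is that left multiplication by a unit preserves the cone law of a letter (✓`ZeroModeSigma.map_mul_left_coneMeasure`), inserted
on the `y`-factor of `coneFour` right after the Weyl ∕ straightening ∕ skew-translation steps of ✓`BlowUp.lintegral_haar_four_eq_coneFour` (before them the
translated integrand is not a class function, so this is the only possible insertion point).
* §1 `measurePreserving_mulLeft_coneMeasure`, `measurePreserving_mulLeftY_coneThree`, ★ `measurePreserving_mulLeftY_coneFour`;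
* §2 ★ `lintegral_haar_four_eq_coneFour_mulLeftY` (`∫ g dHaar⁴ = ∫ g(leaderTuple a (mulLeftY u w)) dconeFour`),
  ★★ `lintegral_haar_four_eq_trGnomonicLeaderChart` (three letters in gnomonic coordinates, the `y`-letter translated; no `dil3`, scale `1`);
* §3 ★★ `trGnomonic_fibre_eq` — the fibre over a hub merged (verbatim twin of ✓`gnomonic_fibre_eq`);
* §4 ★★★ `lintegral_ringMeasure_eq_trGnomonic` — `∫ G dμ_L = ofReal(coneConst³/64·(2π²)^{-|Fol|}) · ∫_cone Σ_ε ∫_η G(fixHistory (ringConfig χ (blowUpPoint 1 (trGnomonicPoint u a ε η))))·gnoDensity η dη da`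
  (the probability normalisation is the SAME number as in the master chart: ✓`gnomonic_total_mass`, not restated).
HONEST LABEL: a change of chart; nothing about ⟨24197⟩, ⟨24194⟩ or any rung is proved here; the Yang–Mills mass gap is NOT proved; no summit is proved by a line.
Seat ym-line-fcl-p3 g47 (cell ym-idea-1, free hands ➎ assembler; item of record ⟨24085⟩ aside, untouched), `--supports stmt-QuantumFields-24197`.
THEOREMS ONLY (0 `def`, 0 `sorry`), standard axioms; the series' local `ℍ` instances.  References: [cite: tHooft1979]; [cite: Luscher1983, §2]; [folklore].
-/

set_option autoImplicit false
set_option synthInstance.maxSize 1024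

noncomputable section

open MeasureTheory Quaternion Set
open scoped Quaternion ENNReal BigOperators
open Literature.MathematicalPhysics.QuantumLattice
open Literature.MathematicalPhysics.QuantumFieldTheory hiding SU2
open Summit.QuantumFields.YangMills.Theorems.SwapTwistDeficit.ToronLog

attribute [local instance] Literature.Analysis.FluidPDE.Tao2016.quatMeasurableSpace
  Literature.Analysis.FluidPDE.Tao2016.quatBorelSpace
  Literature.MathematicalPhysics.QuantumLattice.secondCountableTopology_su2

namespace Summit.QuantumFields.YangMills.Theorems.SwapVirialDeficit.BlowUpRing

open Summit.QuantumFields.YangMills.Theorems.FemtoTransferGap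
open Summit.QuantumFields.YangMills.Theorems.FemtoTransferGap.TT
open Summit.QuantumFields.YangMills.Theorems.VirialFluxGap.RingDeficit
open Summit.QuantumFields.YangMills.Theorems.SwapVirialDeficit.SwapRing
open Summit.QuantumFields.YangMills.Theorems.SwapVirialDeficit.ZeroModeSigma (coneThree coneFour coneThree_def isProbabilityMeasure_coneThree ball3
  measurableSet_ball3 map_mul_left_coneMeasure)
open Summit.QuantumFields.YangMills.Theorems.SwapVirialDeficit.BlowUp (leaderTuple measurable_leaderTuple lintegral_haar_four_eq_coneFour)
open Summit.QuantumFields.YangMills.Theorems.SwapVirialDeficit.Gnomonic (gnomonicWeight piWeight continuous_gnomonicWeight gnomonicWeight_pos piWeight_pos)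

variable {L : ℕ} [NeZero L]

/-! ## §1 Left multiplication by a unit preserves the cone laws -/

/-- Left multiplication by a unit `u` preserves the cone law of one letter (✓`map_mul_left_coneMeasure`). [folklore] -/
theorem measurePreserving_mulLeft_coneMeasure {u : ℍ} (hu : ‖u‖ = 1) : MeasurePreserving (fun y : ℍ => u * y) coneMeasure coneMeasure :=
  ⟨(continuous_const.mul continuous_id).measurable, map_mul_left_coneMeasure hu⟩

/-- `mulLeftY u` preserves `coneThree` for a unit `u`. [folklore] -/
theorem measurePreserving_mulLeftY_coneThree {u : ℍ} (hu : ‖u‖ = 1) : MeasurePreserving (mulLeftY u) coneThree coneThree := by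
  haveI := isProbabilityMeasure_coneMeasure
  have h := ((MeasurePreserving.id coneMeasure).prod (measurePreserving_mulLeft_coneMeasure hu)).prod (MeasurePreserving.id coneMeasure)
  rw [coneThree_def]
  exact h

/-- ★ `(a, w) ↦ (a, mulLeftY u w)` preserves `coneFour` for a unit `u`. [folklore] -/
theorem measurePreserving_mulLeftY_coneFour {u : ℍ} (hu : ‖u‖ = 1) :
    MeasurePreserving (fun q : ℍ × ((ℍ × ℍ) × ℍ) => (q.1, mulLeftY u q.2)) coneFour coneFour := by
  haveI := isProbabilityMeasure_coneMeasure
  haveI := isProbabilityMeasure_coneThree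
  have h := (MeasurePreserving.id coneMeasure).prod (measurePreserving_mulLeftY_coneThree hu)
  rw [coneFour]
  exact h

/-! ## §2 The translated leader chart -/

/-- ★ **THE TRANSLATED CONE CHART**: for a measurable conjugation-invariant `g ≥ 0` on `SU(2)⁴` and a unit `u`,
`∫ g dHaar⁴ = ∫ g (leaderTuple a (mulLeftY u w)) dconeFour(a, w)` (✓`lintegral_haar_four_eq_coneFour`, then `measurePreserving_mulLeftY_coneFour`). [folklore] -/
theorem lintegral_haar_four_eq_coneFour_mulLeftY {u : ℍ} (hu : ‖u‖ = 1) (g : (Fin 4 → SU2) → ℝ≥0∞) (hg : Measurable g)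
    (hinv : ∀ (h : SU2) (C : Fin 4 → SU2), g (fun μ => h * C μ * h⁻¹) = g C) :
    ∫⁻ C, g C ∂(Measure.pi fun _ : Fin 4 => haarProbability SU2) = ∫⁻ q, g (leaderTuple q.1 (mulLeftY u q.2)) ∂coneFour := by
  rw [lintegral_haar_four_eq_coneFour g hg hinv]
  exact ((measurePreserving_mulLeftY_coneFour hu).lintegral_comp (hg.comp measurable_leaderTuple)).symm

/-- ★★ **THE TRANSLATED LEADER CHART IN GNOMONIC COORDINATES**: for every measurable conjugation-invariant `g ≥ 0` on `SU(2)⁴` and every unit `u`,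
`∫ g dHaar⁴ = ofReal(coneConst³) · ∫_cone Σ_{ε₁}∫_{v₁} (Σ_{ε₂}∫_{v₂} (Σ_{ε₃}∫_{v₃} g(leaderTuple a ((±(1,v₁), u·(±(1,v₂))), ±(1,v₃)))·ρ₃/4)·ρ₂/4)·ρ₁/4 da`
(twin of ✓`lintegral_haar_four_eq_gnomonicLeaderChart`: `coneThree = coneConst³·vol³|ball3`, ✓`lintegral_ball3_indicator_eq_gnomonic` for the scale-invariant
`w ↦ g (leaderTuple a (mulLeftY u w))`). [folklore] -/
theorem lintegral_haar_four_eq_trGnomonicLeaderChart {u : ℍ} (hu : ‖u‖ = 1) (g : (Fin 4 → SU2) → ℝ≥0∞) (hg : Measurable g)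
    (hinv : ∀ (h : SU2) (C : Fin 4 → SU2), g (fun μ => h * C μ * h⁻¹) = g C) :
    ∫⁻ C, g C ∂(Measure.pi fun _ : Fin 4 => haarProbability SU2) =
      ENNReal.ofReal (coneConst ^ 3) *
        ∫⁻ a, (∑ ε₁ : Bool, ∫⁻ v₁ : Fin 3 → ℝ, (∑ ε₂ : Bool, ∫⁻ v₂ : Fin 3 → ℝ, (∑ ε₃ : Bool, ∫⁻ v₃ : Fin 3 → ℝ,
          g (leaderTuple a ((gnoLetter ε₁ v₁, u * gnoLetter ε₂ v₂), gnoLetter ε₃ v₃)) * ENNReal.ofReal (gnomonicWeight v₃ / 4)) * ENNReal.ofReal (gnomonicWeight v₂ / 4)) *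
            ENNReal.ofReal (gnomonicWeight v₁ / 4)) ∂coneMeasure := by
  haveI := isProbabilityMeasure_coneMeasure
  haveI := isProbabilityMeasure_coneThree
  have hGm : Measurable fun q : ℍ × ((ℍ × ℍ) × ℍ) => g (leaderTuple q.1 (mulLeftY u q.2)) :=
    hg.comp (measurable_leaderTuple.comp (measurable_fst.prodMk ((measurable_mulLeftY u).comp measurable_snd)))
  rw [lintegral_haar_four_eq_coneFour_mulLeftY hu g hg hinv, coneFour, lintegral_prod _ hGm.aemeasurable]
  have hc0 : 0 ≤ coneConst := coneConst_pos.le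
  have hinner : ∀ a : ℍ, ∫⁻ w, g (leaderTuple a (mulLeftY u w)) ∂coneThree =
      ENNReal.ofReal (coneConst ^ 3) * ∑ ε₁ : Bool, ∫⁻ v₁ : Fin 3 → ℝ, (∑ ε₂ : Bool, ∫⁻ v₂ : Fin 3 → ℝ, (∑ ε₃ : Bool, ∫⁻ v₃ : Fin 3 → ℝ,
        g (leaderTuple a ((gnoLetter ε₁ v₁, u * gnoLetter ε₂ v₂), gnoLetter ε₃ v₃)) * ENNReal.ofReal (gnomonicWeight v₃ / 4)) * ENNReal.ofReal (gnomonicWeight v₂ / 4)) *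
          ENNReal.ofReal (gnomonicWeight v₁ / 4) := by
    intro a
    have hga : Measurable fun w : (ℍ × ℍ) × ℍ => g (leaderTuple a (mulLeftY u w)) := hGm.comp (measurable_const.prodMk measurable_id)
    rw [ZeroModeSigma.coneThree_eq_smul_restrict, lintegral_smul_measure, smul_eq_mul, ← lintegral_indicator measurableSet_ball3,
      ← ENNReal.ofReal_pow hc0]
    congr 1
    exact lintegral_ball3_indicator_eq_gnomonic _ hga (fun t ht x y z => by simp only [mulLeftY_apply, leaderTuple_smul₁ a ht])
      (fun t ht x y z => by simp only [mulLeftY_apply, mul_smul_comm, leaderTuple_smul₂ a ht])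
      (fun t ht x y z => by simp only [mulLeftY_apply, leaderTuple_smul₃ a ht])
  rw [lintegral_congr hinner, lintegral_const_mul' _ _ ENNReal.ofReal_ne_top]

/-! ## §3 The fibre over a hub, merged (translated letters) -/

/-- Measurability of the joint translated integrand at a fixed hub and sign pattern. [folklore] -/
theorem measurable_trGnomonic_integrand (χ : Site 3 L → SU2) {G : (Fin (2 * L - 1 + 1) → GaugeConfig 3 L SU2) × (Site 3 L → SU2) → ℝ≥0∞}
    (hG : Measurable G) (u a : ℍ) (ε : GnoSign L) :
    Measurable fun η : GnoCoord L => G (fixHistory (ringConfig χ (blowUpPoint 1 (trGnomonicPoint u a ε η)))) :=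
  hG.comp (measurable_fixHistory.comp ((measurable_ringConfig χ).comp ((measurable_blowUpPoint 1).comp (measurable_trGnomonicPoint u a ε))))

/-- ★★ **THE FIBRE OVER A HUB, MERGED, TRANSLATED LETTERS**: the verbatim twin of ✓`gnomonic_fibre_eq` with the `y`-letter `u·(±(1,v₂))`
(✓`lintegral_haar_pi_eq_gnomonic` inside, ✓`sum_lintegral_sum_lintegral_mul` three times). [folklore] -/
theorem trGnomonic_fibre_eq (χ : Site 3 L → SU2) {G : (Fin (2 * L - 1 + 1) → GaugeConfig 3 L SU2) × (Site 3 L → SU2) → ℝ≥0∞} (hG : Measurable G) (u a : ℍ) :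
    (∑ ε₁ : Bool, ∫⁻ v₁ : Fin 3 → ℝ, (∑ ε₂ : Bool, ∫⁻ v₂ : Fin 3 → ℝ, (∑ ε₃ : Bool, ∫⁻ v₃ : Fin 3 → ℝ,
        (∫⁻ U, G (fixHistory (ringConfig χ (leaderTuple a ((gnoLetter ε₁ v₁, u * gnoLetter ε₂ v₂), gnoLetter ε₃ v₃), U)))
            ∂(Measure.pi fun _ : Fol L => haarProbability SU2)) *
          ENNReal.ofReal (gnomonicWeight v₃ / 4)) * ENNReal.ofReal (gnomonicWeight v₂ / 4)) * ENNReal.ofReal (gnomonicWeight v₁ / 4)) =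
      ENNReal.ofReal (1 / 64 * (1 / (2 * Real.pi ^ 2)) ^ Fintype.card (Fol L)) *
        ∑ ε : GnoSign L, ∫⁻ η : GnoCoord L, G (fixHistory (ringConfig χ (blowUpPoint 1 (trGnomonicPoint u a ε η)))) * ENNReal.ofReal (gnoDensity η) := by
  classical
  rw [show (volume : Measure (GnoCoord L)) = ((volume : Measure (Fin 3 → ℝ)).prod (volume : Measure (Fin 3 → ℝ))).prod
    ((volume : Measure (Fin 3 → ℝ)).prod (Measure.pi fun _ : Fol L => (volume : Measure (Fin 3 → ℝ)))) from rfl]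
  have hGq : Measurable fun q : (Fin 4 → SU2) × (Fol L → SU2) => G (fixHistory (ringConfig χ q)) :=
    hG.comp (measurable_fixHistory.comp (measurable_ringConfig χ))
  -- the joint integrand, as a function of `(ε, η)`, in letter form
  have hΨ : ∀ ε : GnoSign L, Measurable fun η : GnoCoord L =>
      G (fixHistory (ringConfig χ (leaderTuple a ((gnoLetter ε.1.1 η.1.1, u * gnoLetter ε.1.2 η.1.2), gnoLetter ε.2.1 η.2.1),
        fun i => quatToSU2 (gnoLetter (ε.2.2 i) (η.2.2 i))))) := fun ε => by
    have h := measurable_trGnomonic_integrand χ hG u a ε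
    simp only [blowUpPoint_one_trGnomonicPoint] at h
    exact h
  -- Step F: the followers' Haar integral in gnomonic form, for every leader tuple `C`
  have hF : ∀ C : Fin 4 → SU2, ∫⁻ U, G (fixHistory (ringConfig χ (C, U))) ∂(Measure.pi fun _ : Fol L => haarProbability SU2) =
      ∑ εF : Fol L → Bool, ∫⁻ ηF : Fol L → Fin 3 → ℝ, ENNReal.ofReal (1 / (2 * Real.pi ^ 2)) ^ Fintype.card (Fol L) *
        (G (fixHistory (ringConfig χ (C, fun i => quatToSU2 (gnoLetter (εF i) (ηF i))))) * ENNReal.ofReal (piWeight ηF)) := fun C => by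
    rw [lintegral_haar_pi_eq_gnomonic (fun U : Fol L → SU2 => G (fixHistory (ringConfig χ (C, U))))
      (hGq.comp (measurable_const.prodMk measurable_id)), Finset.mul_sum]
    refine Finset.sum_congr rfl fun εF _ => ?_
    rw [← lintegral_const_mul' _ _ (ENNReal.pow_ne_top ENNReal.ofReal_ne_top)]
    refine lintegral_congr fun ηF => ?_
    rw [prod_ofReal_eq_ofReal_piWeight]
    rfl
  simp only [hF]
  -- Step A: merge `(ε₃, v₃)` with `(εF, ηF)` (under the outer binders)
  have hA : ∀ (ε₁ ε₂ : Bool) (v₁ v₂ : Fin 3 → ℝ),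
      (∑ ε₃ : Bool, ∫⁻ v₃ : Fin 3 → ℝ, (∑ εF : Fol L → Bool, ∫⁻ ηF : Fol L → Fin 3 → ℝ,
          ENNReal.ofReal (1 / (2 * Real.pi ^ 2)) ^ Fintype.card (Fol L) *
            (G (fixHistory (ringConfig χ (leaderTuple a ((gnoLetter ε₁ v₁, u * gnoLetter ε₂ v₂), gnoLetter ε₃ v₃),
              fun i => quatToSU2 (gnoLetter (εF i) (ηF i))))) * ENNReal.ofReal (piWeight ηF))) * ENNReal.ofReal (gnomonicWeight v₃ / 4)) =
        ∑ e' : Bool × (Fol L → Bool), ∫⁻ η₂ : (Fin 3 → ℝ) × (Fol L → Fin 3 → ℝ),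
          ENNReal.ofReal (1 / (2 * Real.pi ^ 2)) ^ Fintype.card (Fol L) *
            (G (fixHistory (ringConfig χ (leaderTuple a ((gnoLetter ε₁ v₁, u * gnoLetter ε₂ v₂), gnoLetter e'.1 η₂.1),
              fun i => quatToSU2 (gnoLetter (e'.2 i) (η₂.2 i))))) * ENNReal.ofReal (piWeight η₂.2)) * ENNReal.ofReal (gnomonicWeight η₂.1 / 4)
          ∂((volume : Measure (Fin 3 → ℝ)).prod (Measure.pi fun _ : Fol L => (volume : Measure (Fin 3 → ℝ)))) := by
    intro ε₁ ε₂ v₁ v₂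
    refine sum_lintegral_sum_lintegral_mul (volume : Measure (Fin 3 → ℝ)) (Measure.pi fun _ : Fol L => (volume : Measure (Fin 3 → ℝ)))
      (Φ := fun (ε₃ : Bool) (εF : Fol L → Bool) (p : (Fin 3 → ℝ) × (Fol L → Fin 3 → ℝ)) =>
        ENNReal.ofReal (1 / (2 * Real.pi ^ 2)) ^ Fintype.card (Fol L) *
          (G (fixHistory (ringConfig χ (leaderTuple a ((gnoLetter ε₁ v₁, u * gnoLetter ε₂ v₂), gnoLetter ε₃ p.1),
            fun i => quatToSU2 (gnoLetter (εF i) (p.2 i))))) * ENNReal.ofReal (piWeight p.2)))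
      (fun ε₃ εF => ?_) measurable_ofReal_gnomonicWeight_div
    have h := (hΨ ((ε₁, ε₂), (ε₃, εF))).comp ((measurable_const (a := (v₁, v₂))).prodMk measurable_id)
    exact measurable_const.mul (h.mul (ENNReal.measurable_ofReal.comp (Gnomonic.continuous_piWeight.measurable.comp measurable_snd)))
  simp only [hA]
  -- Step C: merge `(ε₁, v₁)` with `(ε₂, v₂)`
  rw [sum_lintegral_sum_lintegral_mul (volume : Measure (Fin 3 → ℝ)) (volume : Measure (Fin 3 → ℝ))
    (Φ := fun (ε₁ ε₂ : Bool) (q : (Fin 3 → ℝ) × (Fin 3 → ℝ)) =>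
      (∑ e' : Bool × (Fol L → Bool), ∫⁻ η₂ : (Fin 3 → ℝ) × (Fol L → Fin 3 → ℝ),
          ENNReal.ofReal (1 / (2 * Real.pi ^ 2)) ^ Fintype.card (Fol L) *
            (G (fixHistory (ringConfig χ (leaderTuple a ((gnoLetter ε₁ q.1, u * gnoLetter ε₂ q.2), gnoLetter e'.1 η₂.1),
              fun i => quatToSU2 (gnoLetter (e'.2 i) (η₂.2 i))))) * ENNReal.ofReal (piWeight η₂.2)) * ENNReal.ofReal (gnomonicWeight η₂.1 / 4)
          ∂((volume : Measure (Fin 3 → ℝ)).prod (Measure.pi fun _ : Fol L => (volume : Measure (Fin 3 → ℝ))))) *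
        ENNReal.ofReal (gnomonicWeight q.2 / 4))
    (fun ε₁ ε₂ => ?hC) measurable_ofReal_gnomonicWeight_div]
  case hC =>
    refine (Finset.measurable_sum _ fun e' _ => ?_).mul (measurable_ofReal_gnomonicWeight_div.comp measurable_snd)
    have h := hΨ ((ε₁, ε₂), e')
    exact ((measurable_const.mul (h.mul (ENNReal.measurable_ofReal.comp
      (Gnomonic.continuous_piWeight.measurable.comp (measurable_snd.comp measurable_snd))))).mul
      (measurable_ofReal_gnomonicWeight_div.comp (measurable_fst.comp measurable_snd))).lintegral_prod_right'
  -- Step D: merge `((ε₁,ε₂), (v₁,v₂))` with `((ε₃,εF), (v₃,ηF))`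
  simp only [mul_assoc]
  rw [sum_lintegral_sum_lintegral_mul ((volume : Measure (Fin 3 → ℝ)).prod (volume : Measure (Fin 3 → ℝ)))
    ((volume : Measure (Fin 3 → ℝ)).prod (Measure.pi fun _ : Fol L => (volume : Measure (Fin 3 → ℝ))))
    (Φ := fun (e : Bool × Bool) (e' : Bool × (Fol L → Bool)) (η : GnoCoord L) =>
      ENNReal.ofReal (1 / (2 * Real.pi ^ 2)) ^ Fintype.card (Fol L) *
        (G (fixHistory (ringConfig χ (leaderTuple a ((gnoLetter e.1 η.1.1, u * gnoLetter e.2 η.1.2), gnoLetter e'.1 η.2.1),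
          fun i => quatToSU2 (gnoLetter (e'.2 i) (η.2.2 i))))) * (ENNReal.ofReal (piWeight η.2.2) * ENNReal.ofReal (gnomonicWeight η.2.1 / 4))))
    (w := fun q : (Fin 3 → ℝ) × (Fin 3 → ℝ) => ENNReal.ofReal (gnomonicWeight q.2 / 4) * ENNReal.ofReal (gnomonicWeight q.1 / 4))
    (fun e e' => ?hD) (show Measurable (fun q : (Fin 3 → ℝ) × (Fin 3 → ℝ) => ENNReal.ofReal (gnomonicWeight q.2 / 4) * ENNReal.ofReal (gnomonicWeight q.1 / 4)) from
      (measurable_ofReal_gnomonicWeight_div.comp measurable_snd).mul (measurable_ofReal_gnomonicWeight_div.comp measurable_fst))]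
  case hD =>
    have h := hΨ (e, e')
    exact measurable_const.mul (h.mul ((ENNReal.measurable_ofReal.comp (Gnomonic.continuous_piWeight.measurable.comp (measurable_snd.comp measurable_snd))).mul
      (measurable_ofReal_gnomonicWeight_div.comp (measurable_fst.comp measurable_snd))))
  -- the weights and the constant
  rw [Finset.mul_sum]
  refine Finset.sum_congr rfl fun ε _ => ?_
  rw [← lintegral_const_mul' _ _ ENNReal.ofReal_ne_top]
  refine lintegral_congr fun η => ?_
  rw [blowUpPoint_one_trGnomonicPoint]
  exact gnomonic_weights_rearrange (gnomonic_weights_eq η)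

/-! ## §4 The joint translated gnomonic ring chart -/

/-- ★★★ **THE σ-GLUED RING MEASURE IN THE TRANSLATED JOINT GNOMONIC CHART**: for a central character `χ`, a unit `u` and every measurable
seam-gauge-invariant `G ≥ 0` on the history space,
`∫ G dμ_L = ofReal(coneConst³/64 · (2π²)^{-|Fol L|}) · ∫_cone Σ_{ε : GnoSign L} ∫_{η : GnoCoord L} G(fixHistory (ringConfig χ (blowUpPoint 1 (trGnomonicPoint u a ε η)))) · gnoDensity η dη da`
— the verbatim twin of ✓`lintegral_ringMeasure_eq_gnomonic` with the `y`-letter left-translated by `u` (`C₂ = Q(u·ŷ)`): same constant, same density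
(✓`lintegral_ringMeasure_eq_chart`, ✓`lintegral_pi_chart_conj`, `lintegral_haar_four_eq_trGnomonicLeaderChart`, `trGnomonic_fibre_eq`). [cite: tHooft1979] [cite: Luscher1983, §2] -/
theorem lintegral_ringMeasure_eq_trGnomonic {u : ℍ} (hu : ‖u‖ = 1) (κ : Site 3 L → Site 3 L) {χ : Site 3 L → SU2}
    (hχ : ∀ (x : Site 3 L) (k : SU2), k * χ x = χ x * k)
    {G : (Fin (2 * L - 1 + 1) → GaugeConfig 3 L SU2) × (Site 3 L → SU2) → ℝ≥0∞} (hG : Measurable G)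
    (hinv : ∀ (h : Site 3 L → SU2) (p : (Fin (2 * L - 1 + 1) → GaugeConfig 3 L SU2) × (Site 3 L → SU2)),
      G ((fun i => gaugeTransform h (p.1 i)), h * p.2 * (h ∘ κ)⁻¹) = G p) :
    ∫⁻ p, G p ∂(ringMeasure L) =
      ENNReal.ofReal (coneConst ^ 3 / 64 * (1 / (2 * Real.pi ^ 2)) ^ Fintype.card (Fol L)) *
        ∫⁻ a, (∑ ε : GnoSign L, ∫⁻ η : GnoCoord L,
          G (fixHistory (ringConfig χ (blowUpPoint 1 (trGnomonicPoint u a ε η)))) * ENNReal.ofReal (gnoDensity η)) ∂coneMeasure := by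
  have hGq : Measurable fun q : (Fin 4 → SU2) × (Fol L → SU2) => G (fixHistory (ringConfig χ q)) :=
    hG.comp (measurable_fixHistory.comp (measurable_ringConfig χ))
  have hg : Measurable fun C : Fin 4 → SU2 => ∫⁻ U, G (fixHistory (ringConfig χ (C, U))) ∂(Measure.pi fun _ : Fol L => haarProbability SU2) :=
    hGq.lintegral_prod_right'
  rw [lintegral_ringMeasure_eq_chart κ χ hG hinv, lintegral_prod _ hGq.aemeasurable,
    lintegral_haar_four_eq_trGnomonicLeaderChart hu _ hg (fun k C => lintegral_pi_chart_conj κ hχ hG hinv k C)]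
  rw [lintegral_congr fun a => trGnomonic_fibre_eq χ hG u a, lintegral_const_mul' _ _ ENNReal.ofReal_ne_top, ← mul_assoc,
    ← ENNReal.ofReal_mul (pow_nonneg coneConst_pos.le 3)]
  congr 2
  ring

end Summit.QuantumFields.YangMills.Theorems.SwapVirialDeficit.BlowUpRing

end
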